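import Summits.Parity.GeneralizedHardyLittlewood.Theorems.LeeYangFibresRelativeDimOneTypeDefs
import Summits.Parity.GeneralizedHardyLittlewood.Theorems.LeeYangFibresRelativeDimOneLatticeNecessity
import Literature.Barriers.Parity.SiegelZeroDichotomy
import Mathlib.NumberTheory.DirichletCharacter.Basic
import HarnessLib

/-!
# Route `LeeYangFibres`, crux `RelativeDimOne` (stmt-Parity-14113), line `floating-level-core` (lead seat c5):
# vocabulary of the DEBT-FREE Siegel repulsion — the bare parity atom excludes Siegel zeros WITHOUT
# Matomäki–Merikoski

Route-posited statements (D-0016 `<Route><Crux>…Defs` file) for the reshaped skeleton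
`Cruxes/RelativeDimOne/Lines/floating_level_core.lean` (lead seat c5). NOTHING IS ASSERTED: every `def … : Prop` below is
the type (or a component of the type) of a registered stub; `pairMass` is the one new object. The Gallagher dictionary
identity `sum_classPsi_sq_eq_pairMass` is PROVED (it is the tree's `gallagher_identity`) and is the registered sub-goal
this file lands under.

## Why (the reshape)

The line `floating-level-core` proves `RelativeDimOne ↔ IncidenceBandlimitedCoreDecay (1/4)` modulo ONE theorem in print,
Matomäki–Merikoski 2023 Thm 1.3 (`stub_pairCorrelation`, vendored fact `MatomakiMerikoski2023_pairCorrelation`; XL literature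
debt), used for exactly one implication: the atom P′ excludes Siegel zeros of unbounded quality (`stub_siegelRepulsion`). The
input taken from Matomäki–Merikoski there is the TRUE pair asymptotics under an exceptional zero at the two shifts `2q`, `h₂`.
This vocabulary replaces it by Gallagher's identity read backwards (`Σ_{a mod m} ψ(N;m,a)² = Σ Λ² + pairMass N m`) at TWO
MODULI with the same prime divisors below the conditioning height `w`: the exceptional conductor `q` and its `w`-smooth
radical `d`. Under P′ the pair sums `S_N(h)` are reproduced by a type-invariant decaying spectrum, which type rigidity (R1 of
the landed `stub_typeRigidity`) collapses to a function `g(h)` of the prime divisors `p ≤ w` of `h` (`PairSumModel`); summing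
over the lattices `h ∈ mℕ` the normalised masses `m · pairMass N m / N²` of `m = q` and `m = d` then agree (`PairMassTransfer`,
periodic averaging). But in the presence of a Siegel zero of large quality the class second moment to the NON-exceptional
modulus `d ∤ q`-multiples is sharp (`SiegelNonexcSecondMoment`: the tree's unconditional DH-free Gallagher theorem
`gallagher_nonexceptional`, exceptional clause, + Parseval), so the transferred second moment to the modulus `q` is sharp too,
whence by Parseval (`ExcParsevalLower`) `|ψ(N, χ)| ≤ N/40` throughout `N ∈ [q^A, q^{2A}]` — impossible for the exceptional
character by Tao–Teräväinen's Proposition 3.5 (`SiegelEndgame`, the argument of the landed `…FloatingNoSiegelZeros.lean`).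
Net: `IncidenceBandlimitedCoreDecay θ → ¬UnboundedSiegelZeros` with NO literature debt, and the calibration
`RelativeDimOne ↔ IncidenceBandlimitedCoreDecay (1/4)` becomes unconditional.

References: Gallagher, Mathematika 23 (1976) §2 [Gallagher1976]; Gallagher, Invent. Math. 11 (1970), Thm 7 [Gallagher1970];
Tao–Teräväinen, J. London Math. Soc. 106 (2022), Prop. 3.5 [TaoTeravainen2021]; Green–Tao, Ann. of Math. 171 (2010),
Conj. 1.4 [GreenTao2010].
-/

noncomputable section

open scoped BigOperators Classical ArithmeticFunction.vonMangoldt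
open Finset Literature.NumberTheory.Sieve
open Summit.Parity.GeneralizedHardyLittlewood.Cruxes.RelativeDimOne.GallagherBackwards (classPsi charPsi
  gallagher_identity)
open Summit.Parity.GeneralizedHardyLittlewood.Cruxes.RelativeDimOne.TypeSplit (wlev)

namespace Summit.Parity.GeneralizedHardyLittlewood.Cruxes.RelativeDimOne.FloatingLevelCore

/-! ### The pair-sum lattice mass -/

/-- The PAIR-SUM LATTICE MASS of the modulus `m` at scale `N`:
`pairMass N m = 2 Σ_{1 ≤ k ≤ N/m} S_N(mk)`, `S_N(h) = Σ_{1 ≤ n ≤ N − h} Λ(n)Λ(n + h)` — the off-diagonal part of Gallagher's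
identity `Σ_{a mod m} ψ(N;m,a)² = Σ_{n ≤ N} Λ(n)² + pairMass N m` (`sum_classPsi_sq_eq_pairMass`). Junk `0`-th terms: for
`m = 0` the range is `Icc 1 (N/0) = Icc 1 0 = ∅`, so `pairMass N 0 = 0`. -/
def pairMass (N m : ℕ) : ℝ :=
  2 * ∑ k ∈ Finset.Icc 1 (N / m), ∑ n ∈ Finset.Icc 1 (N - m * k), Λ n * Λ (n + m * k)

/-- **Gallagher's identity in the vocabulary** (the registered sub-goal this file lands under): for `0 < m`,
`Σ_{a mod m} ψ(N; m, a)² = Σ_{n ≤ N} Λ(n)² + pairMass N m` — the tree's `gallagher_identity` (Gallagher 1976 §2). -/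
theorem sum_classPsi_sq_eq_pairMass : ∀ N m : ℕ, 0 < m →
    ∑ a ∈ Finset.range m, classPsi N m a ^ 2 = ∑ n ∈ Finset.Icc 1 N, Λ n ^ 2 + pairMass N m :=
  fun N m hm => gallagher_identity N m hm

/-! ### The statements of the debt-free Siegel repulsion (types of registered stubs; nothing asserted) -/

/-- **PAIR-SUM MODEL** (conclusion of `stub_pairSumModel`, from the atom P′ + type rigidity): there is `C` such that for
every conditioning parameter `D ≥ 1` and accuracy `ε > 0`, eventually in `N`, SOME function `g : ℕ → ℝ` (depending on `N`)
(i) sees a shift `h` only through its prime divisors `p ≤ w`, `w = wlev D N = ⌊log₄ N⌋/D`; (ii) is bounded by `C (w + 1)`;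
(iii) reproduces every pair sum: `|S_N(h) − (N − h) g(h)| ≤ ε N · h/φ(h) + ε N` for `1 ≤ h ≤ N`. (Under P′, `g(h)` is the
`w`-smooth band sum of the core's spectrum at the target `(n, n + h)`.) -/
def PairSumModel : Prop :=
  ∃ C : ℝ, 0 < C ∧ ∀ D : ℕ, 1 ≤ D → ∀ ε : ℝ, 0 < ε → ∃ N₀ : ℕ, ∀ N : ℕ, N₀ ≤ N →
    ∃ g : ℕ → ℝ,
      (∀ h₁ h₂ : ℕ, (∀ p : ℕ, p.Prime → p ≤ wlev D N → (p ∣ h₁ ↔ p ∣ h₂)) → g h₁ = g h₂) ∧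
      (∀ h : ℕ, |g h| ≤ C * ((wlev D N : ℝ) + 1)) ∧
      (∀ h : ℕ, 1 ≤ h → h ≤ N →
        |(∑ n ∈ Finset.Icc 1 (N - h), Λ n * Λ (n + h)) - ((N - h : ℕ) : ℝ) * g h| ≤
          ε * N * ((h : ℝ) / (Nat.totient h : ℝ)) + ε * N)

/-- **PAIR-MASS TRANSFER** (conclusion of `stub_pairMassTransfer`, elementary from `PairSumModel`): for `D ≥ 4` and
`δ > 0`, eventually in `N`, two moduli `m₁, m₂ ≤ N^{1/4}` with the same prime divisors `p ≤ wlev D N` have the same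
normalised pair-sum lattice mass up to `δ (m₁/φ(m₁) + m₂/φ(m₂))`:
`|m₁ pairMass N m₁/N² − m₂ pairMass N m₂/N²| ≤ δ (m₁/φ(m₁) + m₂/φ(m₂))` (periodic averaging of `k ↦ g(k m_i)` over the
primorial of `w`, which is `≤ 4^w ≤ N^{1/D}`). -/
def PairMassTransfer : Prop :=
  ∀ D : ℕ, 4 ≤ D → ∀ δ : ℝ, 0 < δ → ∃ N₀ : ℕ, ∀ N : ℕ, N₀ ≤ N →
    ∀ m₁ m₂ : ℕ, 1 ≤ m₁ → 1 ≤ m₂ → (m₁ : ℝ) ≤ (N : ℝ) ^ (1 / 4 : ℝ) → (m₂ : ℝ) ≤ (N : ℝ) ^ (1 / 4 : ℝ) →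
      (∀ p : ℕ, p.Prime → p ≤ wlev D N → (p ∣ m₁ ↔ p ∣ m₂)) →
        |(m₁ : ℝ) * pairMass N m₁ / (N : ℝ) ^ 2 - (m₂ : ℝ) * pairMass N m₂ / (N : ℝ) ^ 2| ≤
          δ * ((m₁ : ℝ) / (Nat.totient m₁ : ℝ) + (m₂ : ℝ) / (Nat.totient m₂ : ℝ))

/-- **PARSEVAL LOWER BOUND AT ONE CHARACTER** (conclusion of `stub_excParsevalLower`; orthogonality on `(ℤ/qℤ)ˣ`): for a
non-principal `χ mod q`, `(Σ_{n ≤ N, (n,q)=1} Λ(n))² + ‖ψ(N, χ)‖² ≤ φ(q) Σ_{a mod q} ψ(N; q, a)²` (folklore). -/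
def ExcParsevalLower : Prop :=
  ∀ (q : ℕ) [NeZero q] (χ : DirichletCharacter ℂ q), χ ≠ 1 → ∀ N : ℕ,
    (∑ n ∈ (Finset.Icc 1 N).filter (fun n => n.Coprime q), Λ n) ^ 2 + ‖charPsi χ N‖ ^ 2 ≤
      (Nat.totient q : ℝ) * ∑ a ∈ Finset.range q, classPsi N q a ^ 2

/-- **SHARP CLASS SECOND MOMENT TO NON-EXCEPTIONAL MODULI, IN THE PRESENCE OF A SIEGEL ZERO** (conclusion of
`stub_siegelSecondMoment`): there is `c > 0` such that for every `ε > 0` there are a level `0 < θ₁ ≤ 1/4` and `N₁` with: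
for every Siegel zero `(χ mod q, η)` (`IsSiegelZero`: `χ` primitive quadratic, `L(1 − 1/(η log q), χ) = 0`, `η ≥ 10`), every
`N ≥ N₁` with `q ≤ N^{θ₁}` inside the window `θ₁ log N ≤ c η log q` (so that the zero is exceptional at level `N^{θ₁}` in
the sense of Montgomery–Vaughan 1975 §4), and every modulus `1 ≤ d ≤ N^{θ₁}` NOT divisible by `q`,
`Σ_{a mod d} ψ(N; d, a)² ≤ (1 + ε)(N²/φ(d) + N log N)`. (The tree's unconditional `gallagher_nonexceptional`, exceptional
clause — no character mod `d` is induced by `χ` — + Parseval, as in the landed `stub_flatSecondMoment`.) -/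
def SiegelNonexcSecondMoment : Prop :=
  ∃ c : ℝ, 0 < c ∧ ∀ ε : ℝ, 0 < ε → ∃ θ₁ : ℝ, 0 < θ₁ ∧ θ₁ ≤ 1 / 4 ∧ ∃ N₁ : ℕ,
    ∀ (q : ℕ) [NeZero q] (χ : DirichletCharacter ℂ q) (η : ℝ), Literature.Barriers.Parity.IsSiegelZero χ η →
      ∀ N : ℕ, N₁ ≤ N → (q : ℝ) ≤ (N : ℝ) ^ θ₁ → θ₁ * Real.log N ≤ c * η * Real.log q →
        ∀ d : ℕ, 1 ≤ d → (d : ℝ) ≤ (N : ℝ) ^ θ₁ → ¬ q ∣ d →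
          ∑ a ∈ Finset.range d, classPsi N d a ^ 2 ≤
            (1 + ε) * ((N : ℝ) ^ 2 / (Nat.totient d : ℝ) + N * Real.log N)

/-- **SIEGEL ENDGAME** (conclusion of `stub_siegelEndgame`; the argument of the landed
`not_unboundedSiegelZeros_of_uniformCharPNT` over the range `(q^A, q^{2A}]`): for every `A ≥ 1` there are `η₂, q₂` such
that no Siegel zero `(χ mod q, η)` with `η ≥ η₂`, `q ≥ q₂` admits the character prime number theorem
`‖ψ(u, χ)‖ ≤ u/40` throughout `q^A ≤ u ≤ q^{2A}` (Mertens I gives `Σ_{p ∈ (q^A, q^{2A}]} log p/p ≥ A log q − 6`, Abel summation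
gives `|Σ χ(p) log p/p| ≤ 0.15 + A log q/10`, while by Tao–Teräväinen Prop. 3.5 (3.13) the sum `Σ (1 + χ(p)) log p/p` over the
exceptional primes is `≤ 8A²K log q/η`; Tao–Teräväinen 2022, Proposition 3.5 (3.13)). -/
def SiegelEndgame : Prop :=
  ∀ A : ℕ, 1 ≤ A → ∃ η₂ : ℝ, ∃ q₂ : ℕ, ∀ (q : ℕ) [NeZero q] (χ : DirichletCharacter ℂ q) (η : ℝ),
    Literature.Barriers.Parity.IsSiegelZero χ η → η₂ ≤ η → q₂ ≤ q →
      (∀ u : ℕ, q ^ A ≤ u → u ≤ q ^ (2 * A) → ‖charPsi χ u‖ ≤ (u : ℝ) / 40) → False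

end Summit.Parity.GeneralizedHardyLittlewood.Cruxes.RelativeDimOne.FloatingLevelCore

end
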